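import Summits.HubbardSuperconductivity.HubbardSuperconductivity.Theorems.SoloBlindCorrelationBudget
import Literature.MathematicalPhysics.QuantumLattice.HubbardPairDensityCouplingCeilingUniform
import Literature.MathematicalPhysics.QuantumLattice.HubbardDWaveLROCeiling
import HarnessLib

/-!
# Theorem 38 — the every-ground-state `d`-wave ceiling is set by the CORRELATION ENERGY PER SITE,
# in the summit's `liminf` format (solo-blind lineage, generation 36)

Summit `HubbardSuperconductivity` (= `Literature.Hubbard.DWaveSuperconductivityHubbard`). This file
combines Theorem 37 of the lineage (`SoloBlindCorrelationBudget.lean`: for every normalised sector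
ground state `φ` of `hubbardTorus 2 L 1 U`, a paramagnetic Hartree–Fock ACCURACY BUDGET at the doubled
coupling, `E₀(2n) + 2U·n²/L² - Γ ≤ minEnergyOn (hubbardTorus 2 L 1 (2U)) (szSector (2n) 0)`, bounds
the free kinetic excess `re⟨φ, H₀ φ⟩ - E₀(2n) ≤ Γ`) with the tree's two pairing-cost inequalities for
the free Fermi gas (`freeDWavePairing_costs_energy_uniform_rate`: rate `a/(10⁵ log²(4 + 32/√a))` at
every filling; `freeDWavePairing_costs_energy_log_explicit` through Theorem 37(d): rate
`√d₀·a/(4096 log(4 + 32/√a))` at the summit's dopings), and carries the result to the literal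
`liminf` sequence of the summit exactly as the tree files `HubbardPairDensityCouplingCeilingUniform` /
`HubbardDWaveLROCeiling` do for the first-order budget `Γ = U·L²`.

THEOREM 38. Let `U` be real, `γ > 0`, and suppose that eventually in `L` the sector ground energy of
`hubbardTorus 2 L 1 (2U)` in `(N_L, S^z = 0)` is at least the paramagnetic Hartree–Fock value minus
`γ·L²`: `E₀(N_L) + U·N_L²/(2L²) - γ·L² ≤ E_{2U}(N_L)` (`E₀` = free sector minimum). Then for EVERY
family `ψ_L` of normalised sector ground states of `hubbardTorus 2 L 1 U` (any electron numbers `N_L`)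
  `liminf_k |Λ_{2k}|⁻² Σ_{x,y} torusPullback (pairFieldCorr g_d ψ) (2k) x y ≤ 10⁵·γ·log²(4 + 32/√γ)`,
and at the summit's fillings `N_L = 2⌊(1-δ)L²/2⌋`, `δ ∈ (0,1/2)` (hypothesis clause of `hubbard.S01`
verbatim) `≤ (16384/δ)·γ·log(4 + 32/√γ)`. Finite-volume forms: (a) rate form with a general budget
`Γ`, (b)/(d) closed forms, (c)/(e) a-priori `<` forms at every `N`.

READING (prose; the budget is a HYPOTHESIS here, no literature fact is vendored). The two tree
ceilings `10⁵·U·log²(4 + 32/√U)` and `(16384/δ)·U·log(4 + 32/√U)` are the case `γ = U` (first-order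
budget, `re⟨φ,H₀φ⟩ - E₀ ≤ U·n²/L² ≤ U·L²`). Theorem 38 replaces `U` by ANY per-site accuracy `γ` of
paramagnetic Hartree–Fock theory for the ground-state energy at coupling `2U`, i.e. by the
correlation energy per site. With the only such theorem in print for the lattice model — Bach–Poelchau,
J. Math. Phys. 38 (1997) 2072, Thm. 1 (d = 2, Morse dispersion, all fillings; restated with proof
sketch in Wojtkiewicz–Chankowski, Rep. Math. Phys. 92 (2023) 227 = arXiv:2209.02361, Thm. 2.1 and
Lemma 1, whose comparison state is the FREE one-particle density matrix, so the bound is relative to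
the paramagnetic value `E₀ + U·N↑N↓/|Λ|`): `γ(U) = C·(2U)^{4/3}(1 + |ln 2U|)` eventually in `L` — every
ground-state family of the weakly repulsive 2D Hubbard torus has `d`-wave pair density
`O(U^{4/3} log³(1/U))` at every filling and `O_δ(U^{4/3} log²(1/U))` at the summit's dopings. Since the
true correlation energy is of order `U²` per site (second-order perturbation theory), no input can
drive this route below `U² log(1/U)`; the believed truth is `e^{-O(1/U²)}`. This is a CEILING on the
order parameter of any witness of the summit, not a step toward it (necessary side of the lineage's
obstruction atlas, §3 / §5.20(13) of the deliverable).

Sources: V. Bach, J. Poelchau, J. Math. Phys. 38 (1997) 2072–2083 (cited, not formalised);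
A. Wojtkiewicz, P. Chankowski, Rep. Math. Phys. 92 (2023) 227–241, arXiv:2209.02361 §2;
W. Metzner, D. Vollhardt, Phys. Rev. B 39 (1989) 4462 (second-order correlation energy, cited);
D. J. Scalapino, Phys. Rep. 250 (1995) 329, §2 eq. (2.4); J. Bardeen, L. N. Cooper, J. R. Schrieffer,
Phys. Rev. 108 (1957) 1175 §II. Tree inputs by name: `CorrelationBudget.hubbard_groundState_budget`,
`CorrelationBudget.hubbard_groundState_pairDensity_log_budget` (Theorem 37),
`freeDWavePairing_costs_energy_uniform_rate`, `fermiLevel_conditions_doping`,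
`le_mul_log_sq_of_le_mul_log_sq_sqrt_self'`, `le_mul_log_of_le_mul_log_sqrt_self'`,
`mul_mul_log_sq_four_add_pos`, `mul_mul_log_four_add_pos`, `torusLROSeq_pairFieldCorr_succ`,
`exists_eq_two_mul_of_mem_szSector_zero`. No definitions, no named facts.
-/

noncomputable section

namespace Summit.HubbardSuperconductivity.HubbardSuperconductivity.Theorems.BudgetCeiling

open Matrix Finset Filter Literature.Probability.LatticeModels Literature.MathematicalPhysics.QuantumLattice
open Summit.HubbardSuperconductivity.HubbardSuperconductivity.Theorems.CorrelationBudget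
open scoped ComplexOrder

variable {L : ℕ} [NeZero L]

/-! ### Finite volume, every filling: the `log²` pairing rate against a budget -/

/-- **Theorem 38(a): rate form, every filling.** `a > 0`, `L ≥ ⌈3200/√a⌉ + 3`, `U` real; `φ` any
normalised ground state of `hubbardTorus 2 L 1 U` in the sector `(2n, S^z = 0)` with
`a·L⁴ ≤ re⟨φ, Δ_dᴴΔ_d φ⟩`; budget `E₀(2n) + 2U·n²/L² - Γ ≤ E_{2U}(2n)`. Then
`a/(10⁵·log²(4 + 32/√a)) ≤ Γ/L²`: the pairing cost of the density `a` (tree,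
`freeDWavePairing_costs_energy_uniform_rate`) is paid out of the kinetic excess, which Theorem 37(c)
bounds by `Γ`. [this work] -/
theorem hubbard_groundState_pairDensity_rate_le_budget {a : ℝ} (ha : 0 < a)
    (hL : ⌈3200 / Real.sqrt a⌉₊ + 3 ≤ L) {U : ℝ} {n : ℕ} {Γ : ℝ}
    (hΓ : (hubbardTorus 2 L 1 0).minEnergyOn (szSector (Λ := FermionTorus 2 L) (2 * n) 0) +
        2 * U * ((n : ℝ) ^ 2 / (L : ℝ) ^ 2) - Γ ≤
      (hubbardTorus 2 L 1 (2 * U)).minEnergyOn (szSector (Λ := FermionTorus 2 L) (2 * n) 0))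
    {φ : Fock (Orb (FermionTorus 2 L))} (h1 : star φ ⬝ᵥ φ = 1)
    (hφ : IsGroundStateInSector (hubbardTorus 2 L 1 U) (2 * n) 0 φ)
    (hY : a * (L : ℝ) ^ 4 ≤
      (star φ ⬝ᵥ (((pairField dWaveFormFactor L)ᴴ * pairField dWaveFormFactor L) *ᵥ φ)).re) :
    a / (100000 * Real.log (4 + 32 / Real.sqrt a) ^ 2) ≤ Γ / (L : ℝ) ^ 2 := by
  have hL3 : 3 ≤ L := by omega
  have hkin := (hubbard_groundState_budget hL3 hΓ h1 hφ).1
  have hcost := freeDWavePairing_costs_energy_uniform_rate ha hL hφ.1 h1 hY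
  have hL2 : (0 : ℝ) < (L : ℝ) ^ 2 := by
    have : (0 : ℝ) < (L : ℝ) := by exact_mod_cast Nat.pos_of_ne_zero (NeZero.ne L)
    positivity
  rw [le_div_iff₀ hL2]
  linarith

/-- **Theorem 38(b): closed form, every filling.** With a per-site budget `γ > 0`
(`E₀(2n) + 2U·n²/L² - γ·L² ≤ E_{2U}(2n)`) the hypotheses of 38(a) give
`a ≤ 10⁵·γ·log²(4 + 32/√γ)` (elementary inversion `le_mul_log_sq_of_le_mul_log_sq_sqrt_self'`).
The tree's `pairDensity_le_mul_coupling_mul_log_sq_coupling` is the case `γ = U`. [this work] -/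
theorem hubbard_groundState_pairDensity_le_budget_log_sq {a γ : ℝ} (ha : 0 < a) (hγ : 0 < γ)
    (hL : ⌈3200 / Real.sqrt a⌉₊ + 3 ≤ L) {U : ℝ} {n : ℕ}
    (hΓ : (hubbardTorus 2 L 1 0).minEnergyOn (szSector (Λ := FermionTorus 2 L) (2 * n) 0) +
        2 * U * ((n : ℝ) ^ 2 / (L : ℝ) ^ 2) - γ * (L : ℝ) ^ 2 ≤
      (hubbardTorus 2 L 1 (2 * U)).minEnergyOn (szSector (Λ := FermionTorus 2 L) (2 * n) 0))
    {φ : Fock (Orb (FermionTorus 2 L))} (h1 : star φ ⬝ᵥ φ = 1)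
    (hφ : IsGroundStateInSector (hubbardTorus 2 L 1 U) (2 * n) 0 φ)
    (hY : a * (L : ℝ) ^ 4 ≤
      (star φ ⬝ᵥ (((pairField dWaveFormFactor L)ᴴ * pairField dWaveFormFactor L) *ᵥ φ)).re) :
    a ≤ 100000 * γ * Real.log (4 + 32 / Real.sqrt γ) ^ 2 := by
  have h := hubbard_groundState_pairDensity_rate_le_budget ha hL hΓ h1 hφ hY
  have hL2 : (0 : ℝ) < (L : ℝ) ^ 2 := by
    have : (0 : ℝ) < (L : ℝ) := by exact_mod_cast Nat.pos_of_ne_zero (NeZero.ne L)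
    positivity
  have e : γ * (L : ℝ) ^ 2 / (L : ℝ) ^ 2 = γ := by
    rw [mul_div_assoc, div_self hL2.ne', mul_one]
  rw [e] at h
  have hlog : 0 < 100000 * Real.log (4 + 32 / Real.sqrt a) ^ 2 := by
    have := one_le_log_four_add_div_sqrt a
    positivity
  rw [div_le_iff₀ hlog] at h
  have h' : a ≤ 100000 * γ * Real.log (4 + 32 / Real.sqrt a) ^ 2 := by linarith
  exact le_mul_log_sq_of_le_mul_log_sq_sqrt_self' ha (by norm_num) hγ h'

/-- **Theorem 38(c): a-priori form, every `N`.** `c > 10⁵·γ·log²(4 + 32/√γ)`, `γ > 0`,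
`L ≥ ⌈3200/√c⌉ + 3`, `U` real; the budget is written with the electron number `N`
(`U·N²/(2L²) = 2U·(N/2)²/L²`, the paramagnetic Hartree–Fock interaction energy at coupling `2U`).
Every normalised ground state of `hubbardTorus 2 L 1 U` in the sector `(N, S^z = 0)` has
`re⟨φ, Δ_dᴴΔ_d φ⟩ < c·L⁴` (`N` is even or the sector is trivial). [this work] -/
theorem hubbard_groundState_pairDensity_lt_of_budget {c γ U : ℝ} (hc : 0 < c) (hγ : 0 < γ)
    (hcγ : 100000 * γ * Real.log (4 + 32 / Real.sqrt γ) ^ 2 < c)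
    (hL : ⌈3200 / Real.sqrt c⌉₊ + 3 ≤ L) {N : ℕ}
    (hΓ : (hubbardTorus 2 L 1 0).minEnergyOn (szSector (Λ := FermionTorus 2 L) N 0) +
        U * (N : ℝ) ^ 2 / (2 * (L : ℝ) ^ 2) - γ * (L : ℝ) ^ 2 ≤
      (hubbardTorus 2 L 1 (2 * U)).minEnergyOn (szSector (Λ := FermionTorus 2 L) N 0))
    {φ : Fock (Orb (FermionTorus 2 L))}
    (hφ : IsGroundStateInSector (hubbardTorus 2 L 1 U) N 0 φ) (h1 : star φ ⬝ᵥ φ = 1) :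
    (star φ ⬝ᵥ (((pairField dWaveFormFactor L)ᴴ * pairField dWaveFormFactor L) *ᵥ φ)).re <
      c * (L : ℝ) ^ 4 := by
  have h0 : φ ≠ 0 := by rintro rfl; simp at h1
  obtain ⟨n, rfl⟩ := exists_eq_two_mul_of_mem_szSector_zero hφ.1 h0
  have e : U * ((2 * n : ℕ) : ℝ) ^ 2 / (2 * (L : ℝ) ^ 2) = 2 * U * ((n : ℝ) ^ 2 / (L : ℝ) ^ 2) := by
    push_cast
    ring
  have hΓ' : (hubbardTorus 2 L 1 0).minEnergyOn (szSector (Λ := FermionTorus 2 L) (2 * n) 0) +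
        2 * U * ((n : ℝ) ^ 2 / (L : ℝ) ^ 2) - γ * (L : ℝ) ^ 2 ≤
      (hubbardTorus 2 L 1 (2 * U)).minEnergyOn (szSector (Λ := FermionTorus 2 L) (2 * n) 0) := by
    linarith [hΓ, e]
  by_contra h
  have h' := not_lt.1 h
  have := hubbard_groundState_pairDensity_le_budget_log_sq hc hγ hL hΓ' h1 hφ h'
  linarith

/-! ### Finite volume, the summit's dopings: the `log¹` pairing rate against a budget -/

/-- **Theorem 38(d): closed form at hole doping `δ ∈ (0,1/2)`, even side.** `γ > 0`, `a > 0`, EVEN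
`L ≥ ⌈12800/a⌉ + ⌈160/δ⌉ + 17`, `U` real, `m = ⌊(1-δ)L²/2⌋`; budget `E₀(2m) + 2U·m²/L² - γ·L² ≤ E_{2U}(2m)`;
`φ` any normalised ground state of `hubbardTorus 2 L 1 U` in the sector `(2m, S^z = 0)` with
`a·L⁴ ≤ re⟨φ, Δ_dᴴΔ_d φ⟩`. Then `a ≤ (16384/δ)·γ·log(4 + 32/√γ)` (Theorem 37(d) with the Fermi-level
bookkeeping `fermiLevel_conditions_doping`, `d₀ = (δ/4)²`, and the inversion
`le_mul_log_of_le_mul_log_sqrt_self'`). The tree's `hubbardTorus_groundState_dWavePairDensity_le_doped`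
is the case `γ = U`. [this work] -/
theorem hubbard_groundState_pairDensity_le_budget_doped {δ γ a : ℝ}
    (hδ : δ ∈ Set.Ioo (0:ℝ) (1/2)) (hγ : 0 < γ) (ha : 0 < a)
    (hL : ⌈12800 / a⌉₊ + ⌈160 / δ⌉₊ + 17 ≤ L) (hev : Even L) {U : ℝ}
    (hΓ : (hubbardTorus 2 L 1 0).minEnergyOn
          (szSector (Λ := FermionTorus 2 L) (2 * ⌊(1 - δ) * (L : ℝ) ^ 2 / 2⌋₊) 0) +
        2 * U * (((⌊(1 - δ) * (L : ℝ) ^ 2 / 2⌋₊ : ℕ) : ℝ) ^ 2 / (L : ℝ) ^ 2) - γ * (L : ℝ) ^ 2 ≤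
      (hubbardTorus 2 L 1 (2 * U)).minEnergyOn
          (szSector (Λ := FermionTorus 2 L) (2 * ⌊(1 - δ) * (L : ℝ) ^ 2 / 2⌋₊) 0))
    {φ : Fock (Orb (FermionTorus 2 L))} (h1 : star φ ⬝ᵥ φ = 1)
    (hφ : IsGroundStateInSector (hubbardTorus 2 L 1 U) (2 * ⌊(1 - δ) * (L : ℝ) ^ 2 / 2⌋₊) 0 φ)
    (hY : a * (L : ℝ) ^ 4 ≤
      (star φ ⬝ᵥ (((pairField dWaveFormFactor L)ᴴ * pairField dWaveFormFactor L) *ᵥ φ)).re) :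
    a ≤ 16384 / δ * γ * Real.log (4 + 32 / Real.sqrt γ) := by
  obtain ⟨hC1, hC2, hLd⟩ := fermiLevel_conditions_doping hδ L (by omega) hev
  have hL3 : 3 ≤ L := by omega
  have hLa : 12800 ≤ a * (L : ℝ) ^ 2 := by
    have hceil : 12800 / a ≤ (⌈12800 / a⌉₊ : ℝ) := Nat.le_ceil _
    have hL' : (⌈12800 / a⌉₊ : ℝ) ≤ (L : ℝ) := by exact_mod_cast (show ⌈12800 / a⌉₊ ≤ L by omega)
    have hle' : 12800 / a ≤ (L : ℝ) := hceil.trans hL'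
    rw [div_le_iff₀' ha] at hle'
    have hL1 : (1 : ℝ) ≤ L := by exact_mod_cast (show 1 ≤ L by omega)
    nlinarith
  have hd : (0 : ℝ) < (δ / 4) ^ 2 := by have := hδ.1; positivity
  have h := hubbard_groundState_pairDensity_log_budget hL3 hd hLd hC1 hC2 hΓ h1 hφ ha hLa hY
  have hsq : Real.sqrt ((δ / 4) ^ 2) = δ / 4 := Real.sqrt_sq (by linarith [hδ.1])
  have hL2 : (0 : ℝ) < (L : ℝ) ^ 2 := by
    have : (0 : ℝ) < (L : ℝ) := by exact_mod_cast Nat.pos_of_ne_zero (NeZero.ne L)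
    positivity
  have e : γ * (L : ℝ) ^ 2 / (L : ℝ) ^ 2 = γ := by
    rw [mul_div_assoc, div_self hL2.ne', mul_one]
  rw [hsq, e] at h
  have hlog : 0 < Real.log (4 + 32 / Real.sqrt a) := by
    have : (0 : ℝ) ≤ 32 / Real.sqrt a := by positivity
    exact Real.log_pos (by linarith)
  rw [div_le_iff₀ (by positivity)] at h
  have hδ0 := hδ.1
  have h' : a ≤ 16384 / δ * γ * Real.log (4 + 32 / Real.sqrt a) := by
    rw [div_mul_eq_mul_div, div_mul_eq_mul_div, le_div_iff₀ hδ0]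
    linarith
  have hA : (1 : ℝ) ≤ 16384 / δ := by
    rw [le_div_iff₀ hδ0]
    linarith [hδ.2]
  exact le_mul_log_of_le_mul_log_sqrt_self' ha hA hγ h'

/-- **Theorem 38(e): a-priori form at doping `δ`, even side.** `c > (16384/δ)·γ·log(4 + 32/√γ)`,
`γ > 0`, EVEN `L ≥ ⌈12800/c⌉ + ⌈160/δ⌉ + 17`, `U` real, budget in the `N`-form with
`N = 2⌊(1-δ)L²/2⌋`: every normalised ground state of `hubbardTorus 2 L 1 U` in the sector `(N, S^z = 0)`
has `re⟨φ, Δ_dᴴΔ_d φ⟩ < c·L⁴`. [this work] -/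
theorem hubbard_groundState_pairDensity_lt_of_budget_doped {δ γ c U : ℝ}
    (hδ : δ ∈ Set.Ioo (0:ℝ) (1/2)) (hγ : 0 < γ) (hc : 0 < c)
    (hcγ : 16384 / δ * γ * Real.log (4 + 32 / Real.sqrt γ) < c)
    (hL : ⌈12800 / c⌉₊ + ⌈160 / δ⌉₊ + 17 ≤ L) (hev : Even L)
    (hΓ : (hubbardTorus 2 L 1 0).minEnergyOn
          (szSector (Λ := FermionTorus 2 L) (2 * ⌊(1 - δ) * (L : ℝ) ^ 2 / 2⌋₊) 0) +
        U * (((2 * ⌊(1 - δ) * (L : ℝ) ^ 2 / 2⌋₊ : ℕ) : ℝ)) ^ 2 / (2 * (L : ℝ) ^ 2) -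
          γ * (L : ℝ) ^ 2 ≤
      (hubbardTorus 2 L 1 (2 * U)).minEnergyOn
          (szSector (Λ := FermionTorus 2 L) (2 * ⌊(1 - δ) * (L : ℝ) ^ 2 / 2⌋₊) 0))
    {φ : Fock (Orb (FermionTorus 2 L))}
    (hφ : IsGroundStateInSector (hubbardTorus 2 L 1 U) (2 * ⌊(1 - δ) * (L : ℝ) ^ 2 / 2⌋₊) 0 φ)
    (h1 : star φ ⬝ᵥ φ = 1) :
    (star φ ⬝ᵥ (((pairField dWaveFormFactor L)ᴴ * pairField dWaveFormFactor L) *ᵥ φ)).re <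
      c * (L : ℝ) ^ 4 := by
  set m : ℕ := ⌊(1 - δ) * (L : ℝ) ^ 2 / 2⌋₊ with hm
  have e : U * (((2 * m : ℕ) : ℝ)) ^ 2 / (2 * (L : ℝ) ^ 2) = 2 * U * ((m : ℝ) ^ 2 / (L : ℝ) ^ 2) := by
    push_cast
    ring
  have hΓ' : (hubbardTorus 2 L 1 0).minEnergyOn (szSector (Λ := FermionTorus 2 L) (2 * m) 0) +
        2 * U * ((m : ℝ) ^ 2 / (L : ℝ) ^ 2) - γ * (L : ℝ) ^ 2 ≤
      (hubbardTorus 2 L 1 (2 * U)).minEnergyOn (szSector (Λ := FermionTorus 2 L) (2 * m) 0) := by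
    linarith [hΓ, e]
  by_contra h
  have h' := not_lt.1 h
  have := hubbard_groundState_pairDensity_le_budget_doped hδ hγ hc hL hev hΓ' h1 hφ h'
  linarith

/-! ### The summit's format: `liminf` of the even-side LRO sequence -/

omit [NeZero L] in
/-- **Theorem 38(f): budget ceiling on the LRO amplitude in the format of `hubbard.S01`, every
filling.** Let `U` be real, `γ > 0`, `N : ℕ → ℕ` ANY electron numbers and `ψ` a family such that at every
even side `L`, `ψ L` is normalised and a ground state of `hubbardTorus 2 L 1 U` in the sector
`(N L, S^z = 0)`; suppose that eventually in `L` the paramagnetic Hartree–Fock accuracy budget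
`E₀(N L) + U·(N L)²/(2L²) - γ·L² ≤ minEnergyOn (hubbardTorus 2 L 1 (2U)) (szSector (N L) 0)` holds.
Then `liminf_k |Λ_{2k}|⁻² Σ_{x,y ∈ Λ_{2k}} torusPullback (pairFieldCorr g_d ψ) (2k) x y ≤
10⁵·γ·log²(4 + 32/√γ)`. With the Bach–Poelchau budget `γ ≍ U^{4/3}|ln U|` (cited): every witness of
the summit has order-parameter density `O(U^{4/3} log³(1/U))`. The tree's
`liminf_dWavePairFieldCorr_le_of_groundStates_uniform` is the case `γ = U`. [this work] -/
theorem liminf_dWavePairFieldCorr_le_of_groundStates_budget {U γ : ℝ} (hγ : 0 < γ)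
    (N : ℕ → ℕ) (ψ : ∀ L, Fock (Orb (FermionTorus 2 L)))
    (hGS : ∀ L, Even L → star (ψ L) ⬝ᵥ ψ L = 1 ∧
      IsGroundStateInSector (hubbardTorus 2 L 1 U) (N L) 0 (ψ L))
    (hΓ : ∀ᶠ L in atTop,
      (hubbardTorus 2 L 1 0).minEnergyOn (szSector (Λ := FermionTorus 2 L) (N L) 0) +
          U * (N L : ℝ) ^ 2 / (2 * (L : ℝ) ^ 2) - γ * (L : ℝ) ^ 2 ≤
        (hubbardTorus 2 L 1 (2 * U)).minEnergyOn (szSector (Λ := FermionTorus 2 L) (N L) 0)) :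
    liminf (fun k : ℕ => (∑ x ∈ halfOpenBox 2 (2 * k), ∑ y ∈ halfOpenBox 2 (2 * k),
        torusPullback (pairFieldCorr dWaveFormFactor ψ) (2 * k) x y) /
          ((#(halfOpenBox 2 (2 * k)) : ℝ)) ^ 2) atTop ≤
      100000 * γ * Real.log (4 + 32 / Real.sqrt γ) ^ 2 := by
  set C : ℝ := 100000 * γ * Real.log (4 + 32 / Real.sqrt γ) ^ 2 with hC
  set u : ℕ → ℝ := fun k => (∑ x ∈ halfOpenBox 2 (2 * k), ∑ y ∈ halfOpenBox 2 (2 * k),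
      torusPullback (pairFieldCorr dWaveFormFactor ψ) (2 * k) x y) /
        ((#(halfOpenBox 2 (2 * k)) : ℝ)) ^ 2 with hu
  change liminf u atTop ≤ C
  have hC0 : 0 < C := mul_mul_log_sq_four_add_pos (by norm_num) hγ
  have hterm : ∀ k : ℕ, 1 ≤ k → ∃ n : ℕ, 2 * k = n + 1 ∧
      u k = (star (ψ (n + 1)) ⬝ᵥ (((pairField dWaveFormFactor (n + 1))ᴴ *
        pairField dWaveFormFactor (n + 1)) *ᵥ ψ (n + 1))).re / ((n + 1 : ℕ) : ℝ) ^ 4 := by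
    intro k hk
    refine ⟨2 * k - 1, by omega, ?_⟩
    have e : 2 * k = (2 * k - 1) + 1 := by omega
    simp only [hu]
    rw [e, torusLROSeq_pairFieldCorr_succ]
    rfl
  have hnonneg : ∀ k : ℕ, 1 ≤ k → 0 ≤ u k := by
    intro k hk
    obtain ⟨n, -, hn⟩ := hterm k hk
    rw [hn]
    refine div_nonneg ?_ (by positivity)
    exact (posSemidef_conjTranspose_mul_self (pairField dWaveFormFactor (n + 1))).re_dotProduct_nonneg
      (ψ (n + 1))
  have hbdd : IsBoundedUnder (· ≥ ·) atTop u :=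
    isBoundedUnder_of_eventually_ge (a := 0)
      (Filter.eventually_atTop.2 ⟨1, fun k hk => hnonneg k hk⟩)
  obtain ⟨L₀, hL₀⟩ := Filter.eventually_atTop.1 hΓ
  have hev : ∀ c : ℝ, C < c → ∀ᶠ k in atTop, u k ≤ c := by
    intro c hc
    have hc0 : 0 < c := hC0.trans hc
    rw [Filter.eventually_atTop]
    refine ⟨⌈3200 / Real.sqrt c⌉₊ + 4 + L₀, fun k hk => ?_⟩
    obtain ⟨n, hn2, hn⟩ := hterm k (by omega)
    obtain ⟨hnorm, hgs⟩ := hGS (n + 1) ⟨k, by omega⟩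
    haveI : NeZero (n + 1) := ⟨by omega⟩
    have hbud := hL₀ (n + 1) (by omega)
    have hlt := hubbard_groundState_pairDensity_lt_of_budget (L := n + 1) hc0 hγ hc (by omega)
      hbud hgs hnorm
    rw [hn, div_le_iff₀ (by positivity)]
    exact hlt.le
  by_contra hlt
  have hlt' := not_le.1 hlt
  have hmid : C < (C + liminf u atTop) / 2 := by linarith
  have h := liminf_le_of_frequently_le ((hev _ hmid).frequently) hbdd
  linarith

omit [NeZero L] in
/-- **Theorem 38(g): the literal hypothesis clause of `hubbard.S01`, budget form.** For `U` real,
`δ ∈ (0,1/2)`, `γ > 0`, and `(N, ψ)` satisfying the hypothesis clause of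
`Literature.Hubbard.DWaveSuperconductivityHubbard` verbatim (at every even `L`: `N L = 2⌊(1-δ)L²/2⌋`,
`ψ L` normalised, a ground state of `hubbardTorus 2 L 1 U` in the sector `(N L, 0)`), if eventually in
`L` the budget `E₀(N L) + U·(N L)²/(2L²) - γ·L² ≤ minEnergyOn (hubbardTorus 2 L 1 (2U)) (szSector (N L) 0)`
holds, then `liminf_k |Λ_{2k}|⁻² Σ_{x,y ∈ Λ_{2k}} torusPullback (pairFieldCorr g_d ψ) (2k) x y ≤
(16384/δ)·γ·log(4 + 32/√γ)` — so a witness `(U, δ)` of `HubbardSuperconductivity` exhibits an order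
density at most `(16384/δ)·γ(U)·log(4 + 32/√γ(U))` for every admissible budget `γ(U)`
(`O_δ(U^{4/3} log²(1/U))` with Bach–Poelchau). The tree's `liminf_dWavePairFieldCorr_le_of_groundStates`
is the case `γ = U`. [this work] -/
theorem liminf_dWavePairFieldCorr_le_of_groundStates_budget_doping {U δ γ : ℝ}
    (hδ : δ ∈ Set.Ioo (0:ℝ) (1/2)) (hγ : 0 < γ)
    (N : ℕ → ℕ) (ψ : ∀ L, Fock (Orb (FermionTorus 2 L)))
    (hGS : ∀ L, Even L → N L = 2 * ⌊(1 - δ) * (L : ℝ) ^ 2 / 2⌋₊ ∧ star (ψ L) ⬝ᵥ ψ L = 1 ∧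
      IsGroundStateInSector (hubbardTorus 2 L 1 U) (N L) 0 (ψ L))
    (hΓ : ∀ᶠ L in atTop,
      (hubbardTorus 2 L 1 0).minEnergyOn (szSector (Λ := FermionTorus 2 L) (N L) 0) +
          U * (N L : ℝ) ^ 2 / (2 * (L : ℝ) ^ 2) - γ * (L : ℝ) ^ 2 ≤
        (hubbardTorus 2 L 1 (2 * U)).minEnergyOn (szSector (Λ := FermionTorus 2 L) (N L) 0)) :
    liminf (fun k : ℕ => (∑ x ∈ halfOpenBox 2 (2 * k), ∑ y ∈ halfOpenBox 2 (2 * k),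
        torusPullback (pairFieldCorr dWaveFormFactor ψ) (2 * k) x y) /
          ((#(halfOpenBox 2 (2 * k)) : ℝ)) ^ 2) atTop ≤
      16384 / δ * γ * Real.log (4 + 32 / Real.sqrt γ) := by
  set C : ℝ := 16384 / δ * γ * Real.log (4 + 32 / Real.sqrt γ) with hC
  set u : ℕ → ℝ := fun k => (∑ x ∈ halfOpenBox 2 (2 * k), ∑ y ∈ halfOpenBox 2 (2 * k),
      torusPullback (pairFieldCorr dWaveFormFactor ψ) (2 * k) x y) /
        ((#(halfOpenBox 2 (2 * k)) : ℝ)) ^ 2 with hu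
  change liminf u atTop ≤ C
  have hδ0 : 0 < δ := hδ.1
  have hC0 : 0 < C := mul_mul_log_four_add_pos (by positivity) hγ
  have hterm : ∀ k : ℕ, 1 ≤ k → ∃ n : ℕ, 2 * k = n + 1 ∧
      u k = (star (ψ (n + 1)) ⬝ᵥ (((pairField dWaveFormFactor (n + 1))ᴴ *
        pairField dWaveFormFactor (n + 1)) *ᵥ ψ (n + 1))).re / ((n + 1 : ℕ) : ℝ) ^ 4 := by
    intro k hk
    refine ⟨2 * k - 1, by omega, ?_⟩
    have e : 2 * k = (2 * k - 1) + 1 := by omega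
    simp only [hu]
    rw [e, torusLROSeq_pairFieldCorr_succ]
    rfl
  have hnonneg : ∀ k : ℕ, 1 ≤ k → 0 ≤ u k := by
    intro k hk
    obtain ⟨n, -, hn⟩ := hterm k hk
    rw [hn]
    refine div_nonneg ?_ (by positivity)
    exact (posSemidef_conjTranspose_mul_self (pairField dWaveFormFactor (n + 1))).re_dotProduct_nonneg
      (ψ (n + 1))
  have hbdd : IsBoundedUnder (· ≥ ·) atTop u :=
    isBoundedUnder_of_eventually_ge (a := 0)
      (Filter.eventually_atTop.2 ⟨1, fun k hk => hnonneg k hk⟩)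
  obtain ⟨L₀, hL₀⟩ := Filter.eventually_atTop.1 hΓ
  have hev : ∀ c : ℝ, C < c → ∀ᶠ k in atTop, u k ≤ c := by
    intro c hc
    have hc0 : 0 < c := hC0.trans hc
    rw [Filter.eventually_atTop]
    refine ⟨⌈12800 / c⌉₊ + ⌈160 / δ⌉₊ + 18 + L₀, fun k hk => ?_⟩
    obtain ⟨n, hn2, hn⟩ := hterm k (by omega)
    obtain ⟨hN, hnorm, hgs⟩ := hGS (n + 1) ⟨k, by omega⟩
    haveI : NeZero (n + 1) := ⟨by omega⟩
    have hbud := hL₀ (n + 1) (by omega)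
    rw [hN] at hgs hbud
    have hlt := hubbard_groundState_pairDensity_lt_of_budget_doped (L := n + 1) hδ hγ hc0 hc
      (by omega) ⟨k, by omega⟩ hbud hgs hnorm
    rw [hn, div_le_iff₀ (by positivity)]
    exact hlt.le
  by_contra hlt
  have hlt' := not_le.1 hlt
  have hmid : C < (C + liminf u atTop) / 2 := by linarith
  have h := liminf_le_of_frequently_le ((hev _ hmid).frequently) hbdd
  linarith

end Summit.HubbardSuperconductivity.HubbardSuperconductivity.Theorems.BudgetCeiling
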